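import Literature.NumberTheory.EllipticCurves.Kato2004.IwasawaTwistTateShapiroProofs
import HarnessLib

/-!
# Kato (2004), §13.8 / §14.14 — the twisted-Tate Shapiro tower, I: `toTate` on cohomology and the shift

Literature layer — PROOFS ONLY, no new definitions, no axioms.  Continuation of
`Kato2004.IwasawaTwistTateShapiroProofs` towards the left exactness
`ker(H¹(T ⊗ Λ) → H¹(ℚ, T)) ⊆ X · H¹(T ⊗ Λ)` of Kato's (14.14.1) [cite: Kato2004Asterisque, §14.14 (p. 243)],
in the finite-coefficient model `𝕋 = lim_{(n,k)} W[p^k] ⊗ ℤ[Gal(ℚ_n/ℚ)]` of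
`Kato2004.IwasawaTwistTateSystem`:

* §4 `coresLe_refl_apply` — corestriction along `N ≤ N` is the identity (generic);
* §5 `toTate n` on `H¹`: `reduceH1Pk ∘ H¹(toTate n) = H¹(ev_0) ∘ H¹(pr_{(n,k)})`
  (`reduceH1Pk_mapH1AddHom_toTate`) and the conjugation / shift identity
  `conj_γ ∘ H¹(toTate n) ∘ res = H¹(toTate n) ∘ res ∘ H¹(shift)` (`conjMap_mapH1AddHom_toTate`) — the
  cohomological form of `toTate n (γ⁻¹ • ν) = γ⁻¹ • toTate n (shift ν)`, i.e. "`X` acts on the `n`-th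
  layer as `conj_γ − 1`".

References: K. Kato, *p-adic Hodge theory and values of zeta functions of modular forms*, Astérisque 295
(2004), §13.8, §14.14 [cite: Kato2004Asterisque]; J. Neukirch, A. Schmidt, K. Wingberg,
*Cohomology of Number Fields* (2008), I §5 [cite: NeukirchSchmidtWingberg2008].
-/

noncomputable section

open scoped Topology
open Field Filter CategoryTheory Finset
open Literature.NumberTheory.GaloisRepresentations
open Literature.NumberTheory.EllipticCurves
open WeierstrassCurve (geomPoints geomTorsion)

namespace Literature.NumberTheory.GaloisRepresentations

section CoresRefl

universe u v

variable {R : Type u} [Ring R] [TopologicalSpace R]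
variable {G : Type v} [Group G] [TopologicalSpace G] [IsTopologicalGroup G]

/-- **Corestriction along `N ≤ N` is the identity** (for `N` normal and open): by `res ∘ cor = Σ conj`
with the single coset of `N/N`, whose representative lies in `N` and acts trivially on `H¹(N, ·)`.
[cite: NeukirchSchmidtWingberg2008, I §5 (1.5.6)–(1.5.7)] -/
theorem coresLe_refl_apply (X : TopRep.{v} R G) (N : Subgroup G) [N.Normal] (hN : IsOpen (N : Set G))
    [Fintype (N ⧸ N.subgroupOf N)] (ξ : continuousCohomology 1 (subgroupRep X N)) :
    coresLe X (le_refl N) hN ξ = ξ := by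
  classical
  have hs : ∀ x : N ⧸ N.subgroupOf N, ((Quotient.out x : N) : N ⧸ N.subgroupOf N) = x :=
    fun x => QuotientGroup.out_eq' x
  have h := resLe_coresLe_eq_sum_conjMap X (le_refl N) hN hs ξ
  rw [resLe_refl_apply] at h
  rw [h]
  haveI : Subsingleton (N ⧸ N.subgroupOf N) := by
    rw [Subgroup.subgroupOf_self]
    exact QuotientGroup.subsingleton_quotient_top
  rw [Fintype.sum_subsingleton _ (1 : N ⧸ N.subgroupOf N)]
  exact conjMap_one_apply_of_mem X N (Quotient.out (1 : N ⧸ N.subgroupOf N)) ξ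

end CoresRefl

end Literature.NumberTheory.GaloisRepresentations

namespace Literature.NumberTheory.EllipticCurves.Kato2004

open Literature.NumberTheory.EllipticCurves.Kato2004.EulerSystemValues

namespace TwistTate

variable (W : WeierstrassCurve ℚ) [W.IsElliptic] (p : ℕ) [Fact p.Prime]
  [ContinuousSMul ℤ_[p] (W.tateModule p)] (κ : ZpExtension ℚ p)

/-! ## §5 `toTate` on cohomology: reductions and the shift -/

/-- `toTate n` is equivariant for every subgroup of `Γ_n` (hypothesis shape of `mapH1AddHom`).
[cite: Kato2004Asterisque, §13.8 (p. 228)] -/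
theorem toTate_subgroupRep (n : ℕ) {H : Subgroup (absoluteGaloisGroup ℚ)} (hH : H ≤ κ.layerSubgroup n)
    (u : H) (μ : (system W p κ).limit) :
    toTate W p κ n ((subgroupRep (system W p κ).limitRep.toTopRep H).ρ u μ) =
      (subgroupRep (tateRep W p).toTopRep H).ρ u (toTate W p κ n μ) :=
  toTate_smul_of_mem W p κ n (hH u.2) μ

omit [W.IsElliptic] [ContinuousSMul ℤ_[p] (W.tateModule p)] in
/-- The shift is equivariant for every subgroup (hypothesis shape of `mapH1AddHom`).
[cite: Kato2004Asterisque, §14.14 (p. 243)] -/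
theorem shift_subgroupRep (H : Subgroup (absoluteGaloisGroup ℚ)) (u : H) (μ : (system W p κ).limit) :
    shift W p κ ((subgroupRep (system W p κ).limitRep.toTopRep H).ρ u μ) =
      (subgroupRep (system W p κ).limitRep.toTopRep H).ρ u (shift W p κ μ) :=
  shift_smul W p κ (u : absoluteGaloisGroup ℚ) μ

omit [W.IsElliptic] [ContinuousSMul ℤ_[p] (W.tateModule p)] in
/-- The projection `lim → Coeff a` is equivariant for every subgroup. [cite: Kato2004Asterisque, §13.8 (p. 228)] -/
theorem projAddHom_subgroupRep (a : ℕ × ℕ) (H : Subgroup (absoluteGaloisGroup ℚ)) (u : H)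
    (μ : (system W p κ).limit) :
    (system W p κ).projAddHom a ((subgroupRep (system W p κ).limitRep.toTopRep H).ρ u μ) =
      (subgroupRep ((system W p κ).ρ a).toTopRep H).ρ u ((system W p κ).projAddHom a μ) :=
  rfl

/-- **Reduction mod `p^k` of the `toTate n`-image is evaluation at `0` of the `(n,k)`-component**:
`red_{p^k} ∘ H¹(toTate n) = H¹(ev_0) ∘ H¹(proj_{(n,k)})` on `H¹(H, 𝕋)` for `H ≤ Γ_n`.
[cite: Kato2004Asterisque, §13.8 (p. 228)] -/
theorem reduceH1Pk_mapH1AddHom_toTate (n k : ℕ) {H : Subgroup (absoluteGaloisGroup ℚ)}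
    (hH : H ≤ κ.layerSubgroup n) (hct : Continuous (toTate W p κ n))
    (hcp : Continuous ((system W p κ).projAddHom (n, k)))
    (hce : Continuous (Pi.evalAddMonoidHom (fun _ : ZMod (p ^ n) => geomTorsion W ((p : ℤ) ^ k)) 0))
    (c : continuousCohomology 1 (subgroupRep (system W p κ).limitRep.toTopRep H)) :
    reduceH1Pk W p k H (mapH1AddHom (subgroupRep (system W p κ).limitRep.toTopRep H)
        (subgroupRep (tateRep W p).toTopRep H) (toTate W p κ n) hct (toTate_subgroupRep W p κ n hH) c) =
      mapH1AddHom (subgroupRep ((system W p κ).ρ (n, k)).toTopRep H)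
        (subgroupRep (W.torsionGaloisModule ((p : ℤ) ^ k)).toTopRep H)
        (Pi.evalAddMonoidHom (fun _ : ZMod (p ^ n) => geomTorsion W ((p : ℤ) ^ k)) 0) hce
        (eval_subgroupRep W p κ (n, k) hH)
        (mapH1AddHom (subgroupRep (system W p κ).limitRep.toTopRep H)
          (subgroupRep ((system W p κ).ρ (n, k)).toTopRep H) ((system W p κ).projAddHom (n, k)) hcp
          (projAddHom_subgroupRep W p κ (n, k) H) c) := by
  have h1 : reduceH1Pk W p k H (mapH1AddHom (subgroupRep (system W p κ).limitRep.toTopRep H)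
        (subgroupRep (tateRep W p).toTopRep H) (toTate W p κ n) hct (toTate_subgroupRep W p κ n hH) c) =
      mapH1AddHom (subgroupRep (system W p κ).limitRep.toTopRep H)
        (subgroupRep (W.torsionGaloisModule ((p : ℤ) ^ k)).toTopRep H)
        ((tateModPk W p k).comp (toTate W p κ n)) ((continuous_tateModPk W p k).comp hct)
        (fun σ x => by
          rw [AddMonoidHom.comp_apply, AddMonoidHom.comp_apply, toTate_subgroupRep W p κ n hH σ x,
            tateModPk_subgroupRep W p k H σ]) c := by
    unfold reduceH1Pk
    exact mapH1AddHom_mapH1AddHom (X := subgroupRep (system W p κ).limitRep.toTopRep H)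
      (Y := subgroupRep (tateRep W p).toTopRep H)
      (Z := subgroupRep (W.torsionGaloisModule ((p : ℤ) ^ k)).toTopRep H) (toTate W p κ n) hct
      (toTate_subgroupRep W p κ n hH) (tateModPk W p k) (continuous_tateModPk W p k)
      (tateModPk_subgroupRep W p k H) _ _ c
  have h2 : mapH1AddHom (subgroupRep ((system W p κ).ρ (n, k)).toTopRep H)
        (subgroupRep (W.torsionGaloisModule ((p : ℤ) ^ k)).toTopRep H)
        (Pi.evalAddMonoidHom (fun _ : ZMod (p ^ n) => geomTorsion W ((p : ℤ) ^ k)) 0) hce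
        (eval_subgroupRep W p κ (n, k) hH)
        (mapH1AddHom (subgroupRep (system W p κ).limitRep.toTopRep H)
          (subgroupRep ((system W p κ).ρ (n, k)).toTopRep H) ((system W p κ).projAddHom (n, k)) hcp
          (projAddHom_subgroupRep W p κ (n, k) H) c) =
      mapH1AddHom (subgroupRep (system W p κ).limitRep.toTopRep H)
        (subgroupRep (W.torsionGaloisModule ((p : ℤ) ^ k)).toTopRep H)
        ((Pi.evalAddMonoidHom (fun _ : ZMod (p ^ n) => geomTorsion W ((p : ℤ) ^ k)) 0).comp
          ((system W p κ).projAddHom (n, k))) (hce.comp hcp)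
        (fun σ x => by
          rw [AddMonoidHom.comp_apply, AddMonoidHom.comp_apply, projAddHom_subgroupRep W p κ (n, k) H σ x,
            eval_subgroupRep W p κ (n, k) hH]) c :=
    mapH1AddHom_mapH1AddHom (X := subgroupRep (system W p κ).limitRep.toTopRep H)
      (Y := subgroupRep ((system W p κ).ρ (n, k)).toTopRep H)
      (Z := subgroupRep (W.torsionGaloisModule ((p : ℤ) ^ k)).toTopRep H)
      ((system W p κ).projAddHom (n, k)) hcp (projAddHom_subgroupRep W p κ (n, k) H)
      (Pi.evalAddMonoidHom (fun _ : ZMod (p ^ n) => geomTorsion W ((p : ℤ) ^ k)) 0) hce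
      (eval_subgroupRep W p κ (n, k) hH) _ _ c
  rw [h1, h2]
  exact mapH1AddHom_congr (X := subgroupRep (system W p κ).limitRep.toTopRep H)
    (Y := subgroupRep (W.torsionGaloisModule ((p : ℤ) ^ k)).toTopRep H)
    (AddMonoidHom.ext fun μ => tateModPk_toTate W p κ n k μ) _ _ _ _ c

/-- The `Γ_ℚ`-action of `T_pW` in the form `(tateRep W p).toTopRep.ρ g a = g • a`. [folklore] -/
private theorem tateRep_ρ_apply (g : absoluteGaloisGroup ℚ) (a : W.tateModule p) :
    (tateRep W p).toTopRep.ρ g a = g • a := rfl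

omit [W.IsElliptic] [ContinuousSMul ℤ_[p] (W.tateModule p)] in
/-- `toTate n (g · ν)` for a general `g`: the `(n,k)`-components of `g · ν` at `0` are `g • ν_{(n,k)}(−κ̄_n g)`.
[cite: Kato2004Asterisque, §13.8 (p. 228)] -/
theorem proj_toTate_limitRep (n k : ℕ) (g : absoluteGaloisGroup ℚ) (ν : (system W p κ).limit) :
    TateModule.proj p k (toTate W p κ n ((system W p κ).limitRep g ν)) =
      g • (((ν : ∀ a, Coeff W p a) (n, k) (-κ.layerIndex n g) : geomTorsion W ((p : ℤ) ^ k)) :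
        geomPoints W) := by
  rw [proj_toTate, DiscreteInvSystem.coe_limitRep_apply, system_ρ, ZpExtension.twistGroupRing_apply,
    zero_sub, WeierstrassCurve.torsionGaloisModule_apply_apply, AddSubgroup.torsionBy.coe_smul]

omit [W.IsElliptic] [ContinuousSMul ℤ_[p] (W.tateModule p)] in
/-- **`toTate n (γ⁻¹ · ν) = γ⁻¹ • toTate n (shift ν)`** for a topological generator `γ` (`κ̄_n γ = 1`):
the inverse generator moves the identity coset to the coset `1`, which the shift reads off.
[cite: Kato2004Asterisque, §14.14 (p. 243)] -/
theorem toTate_limitRep_inv {γ : absoluteGaloisGroup ℚ} (hγ : κ.IsTopGenerator γ) (n : ℕ)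
    (ν : (system W p κ).limit) :
    toTate W p κ n ((system W p κ).limitRep γ⁻¹ ν) = γ⁻¹ • toTate W p κ n (shift W p κ ν) := by
  refine TateModule.ext fun k => ?_
  have h1 : κ.layerIndex n γ = 1 := by
    rw [ZpExtension.layerIndex, hγ]
    simp
  have hl : TateModule.proj p k (toTate W p κ n ((system W p κ).limitRep γ⁻¹ ν)) =
      γ⁻¹ • (((ν : ∀ a, Coeff W p a) (n, k) 1 : geomTorsion W ((p : ℤ) ^ k)) : geomPoints W) := by
    rw [proj_toTate_limitRep W p κ n k γ⁻¹ ν, ZpExtension.layerIndex_inv, neg_neg, h1]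
  have hr : TateModule.proj p k (γ⁻¹ • toTate W p κ n (shift W p κ ν)) =
      γ⁻¹ • (((ν : ∀ a, Coeff W p a) (n, k) 1 : geomTorsion W ((p : ℤ) ^ k)) : geomPoints W) := by
    rw [TateModule.proj_smul_of_distribMulAction γ⁻¹ (toTate W p κ n (shift W p κ ν)) k,
      proj_toTate W p κ n k (shift W p κ ν), coe_shift_apply, shiftCoeff_apply, zero_add]
  exact hl.trans hr.symm

/-- Abstract form of the cocycle identity behind `conjMap_mapH1AddHom_toTate`: for a crossed
homomorphism `θ` (`θ(ab) = θ a + a·θ b`), additive maps `toT`, `sh` and "actions" `cγ, cγi, cx` with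
`toT (γ₀⁻¹·ν) = cγi (toT (sh ν))`, `sh (u·ν) = u·sh ν`, `toT (u·ν) = cx (toT ν)`, `cγ ∘ cγi = id`:
`cγ (toT (θ(γ₀⁻¹ u γ₀))) − toT (sh (θ u)) = cx w − w` with `w = toT (sh (θ γ₀))` (pure algebra, stated
over bare types so that its use involves no unfolding of the concrete modules). [folklore] -/
private theorem conj_shift_identity {G M T : Type*} [Group G] [AddCommGroup M] [AddCommGroup T]
    (θ : G → M) (A : G → M → M) (toT : M → T) (sh : M → M) (cγ cγi cx : T → T) (γ₀ u : G)
    (hθ : ∀ a b, θ (a * b) = θ a + A a (θ b)) (hθ1 : θ 1 = 0)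
    (hA : ∀ a m m', A a (m + m') = A a m + A a m') (hAn : ∀ a m, A a (-m) = -A a m)
    (htoT : ∀ m m', toT (m + m') = toT m + toT m') (htoTn : ∀ m, toT (-m) = -toT m)
    (hsh : ∀ m m', sh (m + m') = sh m + sh m') (hshn : ∀ m, sh (-m) = -sh m)
    (hcγi : ∀ t t', cγi (t + t') = cγi t + cγi t') (hcγin : ∀ t, cγi (-t) = -cγi t)
    (hcγ : ∀ t t', cγ (t + t') = cγ t + cγ t') (hcγn : ∀ t, cγ (-t) = -cγ t)
    (hT : ∀ ν, toT (A γ₀⁻¹ ν) = cγi (toT (sh ν))) (hS : ∀ ν, sh (A u ν) = A u (sh ν))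
    (hU : ∀ ν, toT (A u ν) = cx (toT ν)) (hγγ : ∀ t, cγ (cγi t) = t) :
    cγ (toT (θ (γ₀⁻¹ * (u * γ₀)))) - toT (sh (θ u)) = cx (toT (sh (θ γ₀))) - toT (sh (θ γ₀)) := by
  have hinv : θ γ₀⁻¹ = -A γ₀⁻¹ (θ γ₀) := by
    have h := hθ γ₀⁻¹ γ₀
    rw [inv_mul_cancel, hθ1] at h
    exact eq_neg_of_add_eq_zero_left h.symm
  rw [hθ, hθ, hinv, ← hAn, ← hA, hT, hsh, hsh, hshn, hS, htoT, htoT, htoTn, hU, hcγi, hcγi, hcγin,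
    hcγ, hcγ, hcγn, hγγ, hγγ, hγγ]
  abel

set_option maxHeartbeats 400000 in
/-- **`conj_γ ∘ H¹(toTate n) ∘ res = H¹(toTate n) ∘ res ∘ H¹(shift)`** on `H¹(Γ_0, 𝕋)`: under the Shapiro
evaluation the action of `γ` on `H¹(ℚ_n, T_pW)` is multiplication by `γ` on `T ⊗ Λ` (the cocycles
differ by the coboundary of `toTate n (shift (θ γ))`).  This is the dictionary `T ↔ conj_γ − 1` of the
pin (`IwasawaH1Data.proj_T_smul`). [cite: Kato2004Asterisque, §13.8 (p. 228) and §14.14 (p. 243)] -/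
theorem conjMap_mapH1AddHom_toTate {γ : absoluteGaloisGroup ℚ} (hγ : κ.IsTopGenerator γ) (n : ℕ)
    (hct : Continuous (toTate W p κ n)) (hcs : Continuous (shift W p κ))
    (Θ : continuousCohomology 1 (subgroupRep (system W p κ).limitRep.toTopRep (κ.layerSubgroup 0))) :
    conjMap (tateRep W p).toTopRep (κ.layerSubgroup n) γ 1
        (mapH1AddHom (subgroupRep (system W p κ).limitRep.toTopRep (κ.layerSubgroup n))
          (subgroupRep (tateRep W p).toTopRep (κ.layerSubgroup n)) (toTate W p κ n) hct
          (toTate_subgroupRep W p κ n le_rfl)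
          (resLe (system W p κ).limitRep.toTopRep (κ.layerSubgroup_antitone (Nat.zero_le n)) 1 Θ)) =
      mapH1AddHom (subgroupRep (system W p κ).limitRep.toTopRep (κ.layerSubgroup n))
        (subgroupRep (tateRep W p).toTopRep (κ.layerSubgroup n)) (toTate W p κ n) hct
        (toTate_subgroupRep W p κ n le_rfl)
        (resLe (system W p κ).limitRep.toTopRep (κ.layerSubgroup_antitone (Nat.zero_le n)) 1
          (mapH1AddHom (subgroupRep (system W p κ).limitRep.toTopRep (κ.layerSubgroup 0))
            (subgroupRep (system W p κ).limitRep.toTopRep (κ.layerSubgroup 0)) (shift W p κ) hcs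
            (shift_subgroupRep W p κ (κ.layerSubgroup 0)) Θ)) := by
  obtain ⟨θ, rfl⟩ := oneCocycleClass_surjective _ Θ
  -- restricted cocycles (existential form: no cocycle-level `resLe` at this concrete module)
  obtain ⟨ψ₁, hψ₁, hres₁⟩ := exists_resLe_oneCocycleClass_eq (system W p κ).limitRep.toTopRep
    (κ.layerSubgroup_antitone (Nat.zero_le n)) θ
  have test₂ := exists_resLe_oneCocycleClass_eq (system W p κ).limitRep.toTopRep
    (κ.layerSubgroup_antitone (Nat.zero_le n))
    (contOneCocycles.pushAddHom (X := subgroupRep (system W p κ).limitRep.toTopRep (κ.layerSubgroup 0))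
      (Y := subgroupRep (system W p κ).limitRep.toTopRep (κ.layerSubgroup 0))
      (shift W p κ) hcs (shift_subgroupRep W p κ (κ.layerSubgroup 0)) θ)
  obtain ⟨ψ₂, hψ₂, hres₂⟩ := test₂
  -- both sides as explicit classes (by congruence: no rewriting across different cohomology groups)
  have eL := congrArg (conjMap (tateRep W p).toTopRep (κ.layerSubgroup n) γ 1)
    ((congrArg (mapH1AddHom (subgroupRep (system W p κ).limitRep.toTopRep (κ.layerSubgroup n))
      (subgroupRep (tateRep W p).toTopRep (κ.layerSubgroup n)) (toTate W p κ n) hct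
      (toTate_subgroupRep W p κ n le_rfl)) hres₁).trans
      (mapH1AddHom_oneCocycleClass (X := subgroupRep (system W p κ).limitRep.toTopRep (κ.layerSubgroup n))
        (Y := subgroupRep (tateRep W p).toTopRep (κ.layerSubgroup n)) (toTate W p κ n) hct
        (toTate_subgroupRep W p κ n le_rfl) ψ₁))
  have eR := (congrArg (mapH1AddHom (subgroupRep (system W p κ).limitRep.toTopRep (κ.layerSubgroup n))
      (subgroupRep (tateRep W p).toTopRep (κ.layerSubgroup n)) (toTate W p κ n) hct
      (toTate_subgroupRep W p κ n le_rfl))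
      ((congrArg (resLe (system W p κ).limitRep.toTopRep (κ.layerSubgroup_antitone (Nat.zero_le n)) 1)
        (mapH1AddHom_oneCocycleClass (X := subgroupRep (system W p κ).limitRep.toTopRep (κ.layerSubgroup 0))
          (Y := subgroupRep (system W p κ).limitRep.toTopRep (κ.layerSubgroup 0)) (shift W p κ) hcs
          (shift_subgroupRep W p κ (κ.layerSubgroup 0)) θ)).trans hres₂)).trans
      (mapH1AddHom_oneCocycleClass (X := subgroupRep (system W p κ).limitRep.toTopRep (κ.layerSubgroup n))
        (Y := subgroupRep (tateRep W p).toTopRep (κ.layerSubgroup n)) (toTate W p κ n) hct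
        (toTate_subgroupRep W p κ n le_rfl) ψ₂)
  refine eL.trans (Eq.trans ?_ eR.symm)
  refine (conjMap_oneCocycleClass _ _ γ _).trans ?_
  rw [← sub_eq_zero, ← oneCocycleClass_sub, oneCocycleClass_eq_zero_iff]
  -- notation: `γ₀ = γ ∈ Γ_0`; the witness is `w = toTate n (shift (θ γ₀))`
  let γ₀ : κ.layerSubgroup 0 := ⟨γ, κ.mem_layerSubgroup_zero γ⟩
  refine ⟨toTate W p κ n (shift W p κ (θ.1 γ₀)), fun x => ?_⟩
  let u : κ.layerSubgroup 0 := Subgroup.inclusion (κ.layerSubgroup_antitone (Nat.zero_le n)) x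
  have hu : (u : absoluteGaloisGroup ℚ) ∈ κ.layerSubgroup n := by
    rw [Subgroup.coe_inclusion]
    exact x.2
  -- the element `γ⁻¹ x γ` of `Γ_0`
  have hx0 : (Subgroup.inclusion (κ.layerSubgroup_antitone (Nat.zero_le n))
      (Literature.NumberTheory.EllipticCurves.subgroupConj (κ.layerSubgroup n) γ x) : κ.layerSubgroup 0) =
        γ₀⁻¹ * (u * γ₀) :=
    Subtype.ext (by simp [γ₀, u, mul_assoc])
  -- the value of the difference of the two cocycles at `x` (by `change`: all steps are definitional)
  change (tateRep W p).toTopRep.ρ γ (toTate W p κ n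
      (ψ₁.1 (Literature.NumberTheory.EllipticCurves.subgroupConj (κ.layerSubgroup n) γ x))) -
      toTate W p κ n (ψ₂.1 x) =
    (subgroupRep (tateRep W p).toTopRep (κ.layerSubgroup n)).ρ x
        (toTate W p κ n (shift W p κ (θ.1 γ₀))) - toTate W p κ n (shift W p κ (θ.1 γ₀))
  rw [hψ₁, hψ₂,
    contOneCocycles.pushAddHom_apply (X := subgroupRep (system W p κ).limitRep.toTopRep (κ.layerSubgroup 0))
      (Y := subgroupRep (system W p κ).limitRep.toTopRep (κ.layerSubgroup 0)) (shift W p κ) hcs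
      (shift_subgroupRep W p κ (κ.layerSubgroup 0)) θ
      (Subgroup.inclusion (κ.layerSubgroup_antitone (Nat.zero_le n)) x), hx0]
  -- pure algebra (`conj_shift_identity`) with the concrete maps
  exact conj_shift_identity (fun g => θ.1 g)
    (fun σ m => (subgroupRep (system W p κ).limitRep.toTopRep (κ.layerSubgroup 0)).ρ σ m)
    (toTate W p κ n) (shift W p κ) (fun t => (tateRep W p).toTopRep.ρ γ t) (fun t => γ⁻¹ • t)
    (fun t => (subgroupRep (tateRep W p).toTopRep (κ.layerSubgroup n)).ρ x t) γ₀ u θ.2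
    (contOneCocycles.apply_one θ) (fun a m m' => map_add _ m m') (fun a m => map_neg _ m)
    (map_add _) (map_neg _) (map_add _) (map_neg _) (fun t t' => smul_add _ t t') (fun t => smul_neg _ t)
    (fun t t' => map_add _ t t') (fun t => map_neg _ t)
    (fun ν => toTate_limitRep_inv W p κ hγ n ν) (fun ν => shift_smul W p κ (u : absoluteGaloisGroup ℚ) ν)
    (fun ν => toTate_smul_of_mem W p κ n hu ν)
    (fun t => by
      change γ • γ⁻¹ • t = t
      rw [smul_smul, mul_inv_cancel, one_smul])

end TwistTate

end Literature.NumberTheory.EllipticCurves.Kato2004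

end
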